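import Summits.ABC.IUTFork.Cor312HullGainRamified
import Summits.ABC.IUTFork.Cor312PilotIdelesPrThetaSide
import HarnessLib

/-!
# [IUTchIII] Cor. 3.12, statement — `−deĝ_lgp(P_Θ) < −|log(Θ)|` STRICTLY at the print-normalised sharp setting of record
# when `F` has a ramified place over a prime not under `S` (global form of the idele-free hull gain)

PROOF-ONLY sequel (abc-iut cell, Cor. 3.12 sub-crew, seat abc-iut-c312-5, gen 5; row «RAMIFIED-GAIN», global form) of
`Cor312HullGainRamified` (p439709); TAKES NO SIDE on [IUTchIII] Cor. 3.12; no definition, no `Prop` fact, no instance.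
abc-iut-c312-7's `neg_ndegLgp_le_negLogTheta_settingPrVolSharp` (`Cor312PilotIdelesPrThetaSide`, p426498) is the TRIVIAL
direction `−deĝ_lgp(P_Θ) ≤ −|log(Θ)|` at `Real.settingPrVolSharp` for Θ-ideles realising `P_Θ`: every Kummer image lies in
the holomorphic hull of the union of the possible images ([IUTchIII] Cor. 3.12 proof, kurims `paper:url-4b091feeb646`
p. 174 l. 50 – p. 175 l. 1) and the packet-normalised log-volume is monotone. THIS FILE makes it STRICT as soon as `F`
has a place `v` over a prime `p` not under `S` with absolute ramification `2 ≤ e_v ≤ i+2` for some label `i+1 ∈ 𝔽_l^⋇`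
(`Cor312HullGainRamified.thetaLocal_settingPrVolSharp_pos_of_ramified`: the local Θ-volume at `(i+1, p)` is `> 0`
while every Kummer image there has volume `0`):

* `finsum_lt_finsum_of_le_of_lt`, `processionNormalized_lt_of_le_of_lt` — strict versions of the order bookkeeping
  ([IUTchIII] Prop. 3.9 (i)–(iii): procession normalisation and the sum over `v_ℚ`);
* `logvol_thetaRegion_settingPrVolSharp_eq_zero_of_units` — at a prime not under `S` every Kummer image of the Θ-pilot
  at `(i+1, p)` has packet-normalised log-volume `0` (abc-iut-c312-7 `logvol_thetaRegion3_sharp_Pr_inr`, unit ideles);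
* **`neg_ndegLgp_lt_negLogTheta_settingPrVolSharp_of_ramified`** : `↑(−deĝ_lgp(P_Θ)) < −|log(Θ)|`.
So, at the genuine sharp setting over such an `F`, the inequality `−deĝ_lgp(P_Θ) ≤ −|log(Θ)|` of record is never an
equality: the (Ind1)/(Ind2)-hull contributes a strictly positive, idele-free amount at the ramified packets (the
log-different mechanism of [IUTchIV] Thm. 1.10 Step (v), Dupuy–Hilado reading of (Ind2)). HONEST SCOPE as in the
parent file; nothing here evaluates the sign of `−|log(Θ)| − (−|log(q)|)`. [cite: DupuyHilado2025, §3.6, §3.9, §4.9]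
[cite: Mochizuki2012, IUTchIV Thm 1.10 proof Step (v) p. 27–28] [claim: Mochizuki2012, status: disputed]
-/

noncomputable section

open Set Function NumberField IsDedekindDomain Metric
open scoped Pointwise

namespace Summit.ABC

namespace IUTFork

namespace Thm311

namespace Real

open Cor312 Cor312.Setting Cor312Vol Literature.IUT.LogThetaLattice Literature.IUT.LogVolume

/-! ## §0. Strict order bookkeeping -/

/-- **Strict comparison of finitely supported sums**: `f ≤ g` pointwise and `f i₀ < g i₀` give `Σᶠ f < Σᶠ g`.
[folklore] -/
theorem finsum_lt_finsum_of_le_of_lt {ι : Type*} {f g : ι → ℝ} (hf : f.support.Finite) (hg : g.support.Finite)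
    (hle : ∀ i, f i ≤ g i) {i₀ : ι} (hlt : f i₀ < g i₀) : ∑ᶠ i, f i < ∑ᶠ i, g i := by
  classical
  set s : Finset ι := hf.toFinset ∪ hg.toFinset with hs
  have hfs : f.support ⊆ (s : Set ι) := fun i hi => by
    rw [hs, Finset.coe_union]
    exact Or.inl (hf.mem_toFinset.mpr hi)
  have hgs : g.support ⊆ (s : Set ι) := fun i hi => by
    rw [hs, Finset.coe_union]
    exact Or.inr (hg.mem_toFinset.mpr hi)
  rw [finsum_eq_sum_of_support_subset f hfs, finsum_eq_sum_of_support_subset g hgs]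
  refine Finset.sum_lt_sum (fun i _ => hle i) ⟨i₀, ?_, hlt⟩
  by_contra hi
  have hf0 : f i₀ = 0 := Function.notMem_support.mp fun h => hi (hfs h)
  have hg0 : g i₀ = 0 := Function.notMem_support.mp fun h => hi (hgs h)
  rw [hf0, hg0] at hlt
  exact lt_irrefl _ hlt

/-- **Strict monotonicity of the procession normalisation** `(Σ_j v_j)/ℓ⋆` ([IUTchIII] Prop. 3.9 (i)). [folklore] -/
theorem processionNormalized_lt_of_le_of_lt {lstar : ℕ} (hl : 0 < lstar) {f g : Fin lstar → ℝ} (hle : ∀ i, f i ≤ g i)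
    {i₀ : Fin lstar} (hlt : f i₀ < g i₀) : processionNormalized f < processionNormalized g := by
  unfold processionNormalized
  exact div_lt_div_of_pos_right (Finset.sum_lt_sum (fun i _ => hle i) ⟨i₀, Finset.mem_univ _, hlt⟩)
    (by exact_mod_cast hl)

/-! ## §1. The strict global inequality -/

variable {F : Type} [Field F] [NumberField F] (X : PilotData F) {logv : PadicLogs F} (hlog : LogvAnalytic logv)

variable (M : Type) [Field M] [NumberField M]
  (archPk : ∀ (j : (thetaIndex X).Label) (vQ : (thetaIndex X).VQ), Set ((logShellsDH X logv).Packet j vQ))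
  (archSub : ∀ (j : (thetaIndex X).Label) (v : (thetaIndex X).V),
    Set ((logShellsDH X logv).Packet j ((thetaIndex X).over v)))
  (Ψ : ℤ → ∀ v : (thetaIndex X).V, v ∈ (thetaIndex X).Vbad → Set ((logShellsDH X logv).StarPacket v))
  (act : ℤ → ∀ v : (thetaIndex X).V, v ∈ (thetaIndex X).Vbad →
    (logShellsDH X logv).StarPacket v → Module.End ℚ ((logShellsDH X logv).StarPacket v))
  (Mmod : ℤ → ∀ j : (thetaIndex X).LabelStar, Set ((logShellsDH X logv).GlobalPacket j.1))
  (region : ℤ → ∀ j : (thetaIndex X).LabelStar, FinDivisor M → ∀ vQ : (thetaIndex X).VQ,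
    Set ((logShellsDH X logv).Packet j.1 vQ))
  (n : ℤ)
  (t : ∀ (pp : Nat.Primes) (_ : Fin X.lstar) (x : (thetaIndex X).Fibre (.inr pp)),
    haveI : Fact (pp : ℕ).Prime := ⟨pp.2⟩; kOf X pp.1 x)
  (tq : ∀ (pp : Nat.Primes) (x : (thetaIndex X).Fibre (.inr pp)),
    haveI : Fact (pp : ℕ).Prime := ⟨pp.2⟩; kOf X pp.1 x)
  {HT : Type} {LogLink : HT → HT → Type} {IsFull : ∀ {s t : HT}, LogLink s t → Prop}
  (lat : LGPGaussianLogThetaLattice LogLink IsFull)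
  {Frd : Type} {IsoF : Frd → Frd → Type} {Ob : Frd → Type} {realify : Frd → Frd} {Strip : Type}
  {IsoS : Strip → Strip → Type} {Mv : ∀ v : (thetaIndex X).V, v ∈ (thetaIndex X).Vbad → Type}
  [∀ v h, Monoid (Mv v h)]
  (sig : GlobalLGPFrobenioidSignature (thetaIndex X).lstar (thetaIndex X).V (· ∈ (thetaIndex X).Vbad)
    Frd IsoF Ob realify Strip IsoS Mv)
  (split : SplittingMonoids Mv) {ObΔ : Type} {N : ∀ v : (thetaIndex X).V, v ∈ (thetaIndex X).Vbad → Type}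
  [∀ v h, Monoid (N v h)] (qData : QPilotData ObΔ N)

/-- **At a prime not under `S`, every Kummer image of the Θ-pilot at `(i+1, p)` has log-volume `0`** in the
print-normalised sharp setting (its box is `𝒪_L`: abc-iut-c312-7 `logvol_thetaRegion3_sharp_Pr_inr` with unit ideles; the
Kummer images do not depend on the lattice position `m`, Dupuy–Hilado §4.10). [cite: DupuyHilado2025, §3.9, §4.10] -/
theorem logvol_thetaRegion_settingPrVolSharp_eq_zero_of_units (ht0 : ∀ pp i x, t pp i x ≠ 0) (htq0 : ∀ pp x, tq pp x ≠ 0)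
    (htq1 : ∀ (pp : Nat.Primes) (x : (thetaIndex X).Fibre (.inr pp)),
      haveI : Fact (pp : ℕ).Prime := ⟨pp.2⟩; placeOf X pp.1 x ∉ X.S → ‖tq pp x‖ = 1)
    (i : Fin (thetaIndex X).lstar) (pp : Nat.Primes)
    (h1 : ∀ x : (thetaIndex X).Fibre (.inr pp), haveI : Fact (pp : ℕ).Prime := ⟨pp.2⟩; ‖t pp i x‖ = 1) (m : ℤ) :
    ((situationPrVol X hlog M archPk archSub Ψ act Mmod region).D n).logvol (Setting.labelSucc i) (.inr pp)
      ((settingPrVolSharp X hlog M archPk archSub Ψ act Mmod region n lat sig split qData tq t htq0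
        htq1).thetaRegion m (Setting.labelSucc i) (.inr pp)) = 0 := by
  haveI : Fact (pp : ℕ).Prime := ⟨pp.2⟩
  -- the Kummer image at position `m` IS the (Ind3)-region (constant boxes)
  have hreg : (settingPrVolSharp X hlog M archPk archSub Ψ act Mmod region n lat sig split qData tq t htq0
        htq1).thetaRegion m (Setting.labelSucc i) (.inr pp) =
      (settingPrVolSharp X hlog M archPk archSub Ψ act Mmod region n lat sig split qData tq t htq0
        htq1).thetaRegion3 (Setting.labelSucc i) (.inr pp) :=
    Set.ext fun y => ⟨fun h => Set.mem_iUnion.mpr ⟨m, h⟩, fun h => by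
      obtain ⟨m', hm'⟩ := Set.mem_iUnion.mp h
      exact hm'⟩
  rw [hreg]
  show ((situationPrVol X hlog M archPk archSub Ψ act Mmod region).D n).logvol (Setting.labelSucc i) (.inr pp)
      ((settingPrVol X hlog M archPk archSub Ψ act Mmod region n lat sig split qData
        (fun _ _ => thetaBoxDH X hlog (sharpBoxDH X hlog t)) (fun _ => qCentreDH X hlog tq)
          (qCentreDH_ne_zero X hlog tq htq0)
          (finite_support_logvol_qRegion_Pr X hlog M archPk archSub Ψ act Mmod region n tq htq0 htq1)).thetaRegion3
        (Setting.labelSucc i) (.inr pp)) = 0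
  rw [logvol_thetaRegion3_sharp_Pr_inr X hlog M archPk archSub Ψ act Mmod region n lat sig split qData _ _ _ t ht0 i pp]
  exact Finset.sum_eq_zero fun e _ => by rw [h1, Real.log_one, mul_zero]

open Literature.NumberTheory.NumberFields in
/-- **`−deĝ_lgp(P_Θ) < −|log(Θ)|` STRICTLY at the print-normalised sharp setting of record** for Θ-ideles realising
`P_Θ` (units off `S`), as soon as `F` has a place `v` over a prime `p` NOT under `S` with `2 ≤ e_v ≤ |S^±_{i+2}| = i+2`
for some label `i+1`: abc-iut-c312-7's `≤` (every Kummer image lies in the hull, monotone volume) is strict because at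
`(i+1, p)` every Kummer image has volume `0` while the hull has volume `> 0` (`thetaLocal_settingPrVolSharp_pos_of_ramified`).
[cite: DupuyHilado2025, §3.9, §4.9, Thm. 3.10.1] [claim: Mochizuki2012, status: disputed] -/
theorem neg_ndegLgp_lt_negLogTheta_settingPrVolSharp_of_ramified (ht0 : ∀ pp i x, t pp i x ≠ 0)
    (ht1 : ∀ (pp : Nat.Primes) (i : Fin X.lstar) (x : (thetaIndex X).Fibre (.inr pp)),
      haveI : Fact (pp : ℕ).Prime := ⟨pp.2⟩; placeOf X pp.1 x ∉ X.S → ‖t pp i x‖ = 1)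
    (ht : ∀ (pp : Nat.Primes) (i : Fin X.lstar) (x : (thetaIndex X).Fibre (.inr pp)),
      haveI : Fact (pp : ℕ).Prime := ⟨pp.2⟩
      Real.log ‖t pp i x‖ = -(X.thetaPilot i (placeOf X pp.1 x)) * logNorm F (placeOf X pp.1 x) /
        localDegree F (placeOf X pp.1 x))
    (htq0 : ∀ pp x, tq pp x ≠ 0)
    (htq1 : ∀ (pp : Nat.Primes) (x : (thetaIndex X).Fibre (.inr pp)),
      haveI : Fact (pp : ℕ).Prime := ⟨pp.2⟩; placeOf X pp.1 x ∉ X.S → ‖tq pp x‖ = 1)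
    (i : Fin (thetaIndex X).lstar) (pp : Nat.Primes) [Fact (pp : ℕ).Prime]
    (hS : ∀ x : (thetaIndex X).Fibre (.inr pp), placeOf X pp.1 x ∉ X.S)
    (v : HeightOneSpectrum (𝓞 F)) (hv : (thetaIndex X).over (.inr v) = .inr pp)
    (hvp : ((pp : ℕ) : 𝓞 F) ∈ v.asIdeal) (he : 2 ≤ absRamificationIdx (pp : ℕ) (RescaledCompletion F (pp : ℕ) v hvp))
    (hei : absRamificationIdx (pp : ℕ) (RescaledCompletion F (pp : ℕ) v hvp) ≤
      Fintype.card ((thetaIndex X).Caps (Setting.labelSucc i))) :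
    (((-LgpDivisor.ndegLgp X.thetaPilot : ℝ)) : WithTop ℝ) <
      (settingPrVolSharp X hlog M archPk archSub Ψ act Mmod region n lat sig split qData tq t htq0 htq1).negLogTheta := by
  have hfin := thetaFinite_settingPrVolSharp X hlog M archPk archSub Ψ act Mmod region n lat sig split qData t tq ht0 ht1
    htq0 htq1
  have hadm := thetaRegionsAdm_settingPrVolSharp X hlog M archPk archSub Ψ act Mmod region n lat sig split qData t tq ht0
    htq0 htq1
  have hmono := logvolMono_settingPrVol X hlog M archPk archSub Ψ act Mmod region n lat sig split qData
    (fun _ _ => thetaBoxDH X hlog (sharpBoxDH X hlog t)) (fun _ => qCentreDH X hlog tq)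
    (qCentreDH_ne_zero X hlog tq htq0)
    (finite_support_logvol_qRegion_Pr X hlog M archPk archSub Ψ act Mmod region n tq htq0 htq1)
  unfold Setting.negLogTheta
  rw [if_pos hfin, WithTop.coe_lt_coe,
    ← processionNormalized_thetaRegion_settingPrVolSharp X hlog M archPk archSub Ψ act Mmod region n lat sig split qData
      t ht0 ht tq htq0 htq1 (fun _ _ => 0)]
  refine processionNormalized_lt_of_le_of_lt i.pos (fun i' => finsum_le_finsum'
    (finite_support_logvol_thetaRegion_sharp_Pr X hlog M archPk archSub Ψ act Mmod region n lat sig split qData t ht0 ht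
      _ _ _ 0 i')
    (hfin.2 i') fun vQ => logvol_thetaRegion_le_thetaLocal_of_mono hmono hfin hadm 0 i' vQ) (i₀ := i) ?_
  refine finsum_lt_finsum_of_le_of_lt
    (finite_support_logvol_thetaRegion_sharp_Pr X hlog M archPk archSub Ψ act Mmod region n lat sig split qData t ht0 ht
      _ _ _ 0 i)
    (hfin.2 i) (fun vQ => logvol_thetaRegion_le_thetaLocal_of_mono hmono hfin hadm 0 i vQ) (i₀ := .inr pp) ?_
  -- at `(i+1, p)`: Kummer image volume `0` < hull volume
  have h1 : ∀ x : (thetaIndex X).Fibre (.inr pp), ‖t pp i x‖ = 1 := fun x => ht1 pp i x (hS x)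
  rw [logvol_thetaRegion_settingPrVolSharp_eq_zero_of_units X hlog M archPk archSub Ψ act Mmod region n t tq lat sig split
    qData ht0 htq0 htq1 i pp h1 0]
  have hpos := thetaLocal_settingPrVolSharp_pos_of_ramified X hlog M archPk archSub Ψ act Mmod region n t tq lat sig split
    qData ht0 ht1 htq0 htq1 i pp hS v hv hvp he hei
  obtain ⟨r, hr⟩ := WithTop.ne_top_iff_exists.mp (hfin.1 i (.inr pp))
  rw [← hr] at hpos ⊢
  rw [WithTop.untopD_coe]
  exact WithTop.coe_pos.mp hpos

end Real

end Thm311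

end IUTFork

end Summit.ABC

end
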